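import Summits.Ventures.LatticeQCDFlow.Exactness.Phi4HMCLevelsGrowth
import Summits.Ventures.LatticeQCDFlow.Exactness.Phi4HMCTailRejection
import HarnessLib

/-!
# The leapfrog overshoots the quartic wall, V: `N` qpq steps — tail rejection for EVERY trajectory length

HONEST FRAMING: exact (Metropolis-corrected) sampling algorithms for lattice gauge theory;
figures of merit are autocorrelation/cost numbers at stated couplings and volumes; no
continuum-physics claim.  (SCALAR calibration rung S0-A: not a gauge result.)

Venture `LatticeQCDFlow` (cell pub-lqcd), topic `Exactness`; FANOUT row 2 (`s0-phi4`, HMC arm).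
NEW WORK of the cell over `Exactness/Phi4HMCLeapfrogStages.lean` (the stage invariant and its level
map `Φ`), `Exactness/Phi4HMCLevelsGrowth.lean` (growth of the levels) and
`Exactness/Phi4HMCTailRejection.lean` (`N = 1`; thresholds, box lemmas).  Nothing is cited as a fact; printed
counterpart NAMED ONLY: Livingstone–Betancourt–Byrne–Girolami 2019 Thm 5.13 (isotropic hypotheses,
violated by the lattice potential for `V ≥ 3`).

## What is proved (`Λ = Fin (n+1)`, `V = n+1`, `C_J = Σ|J|`, `λ > 0`, `δ > 0`, box `A_t = {t ≤ φ_x ≤ 2t ∀x}`)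

* **`leapfrog_momentum_sq_ge_of_mem_box`** — after `N ≥ 1` qpq steps from the far box (momenta
  `|p_y| ≤ t/δ`) every momentum component satisfies `p_{N,y}² ≥ (c t^{3^N})²`, `t` beyond a threshold;
* `hmc_energy_gap_of_momentum_bound`, **`hmc_energy_gap_of_mem_box_N`** — for every `N ≥ 1` and `L ≥ 0` there is `T` such that for
  `t ≥ T`, `φ ∈ A_t`, `|p_y| ≤ t/δ`: `H(Ψ_N(φ,p)) − H(φ,p) ≥ L`, `Ψ_N = hmcProposal J λ δ N`;
* `involAccept_le_of_gap`, `accept_le_of_gap` — a gap `≥ L` on the good momenta gives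
  `Z_p⁻¹∫ a(φ,p) e^{−½Σp²} dp ≤ e^{−L} + V(δ/t)²` (Chebyshev for the far momenta), any `N`;
* **`hmcPhi4_accept_le_of_mem_box_eventually`**, `hmcPhi4_accept_le_of_mem_box` — every `N ≥ 1`:
  for every `ε > 0` there is `T ≥ 1` such that for every `t ≥ T` (resp. some `t ≥ max(T₀, 1)`), from
  EVERY `φ ∈ A_t` the `N`-step HMC update is accepted with probability at most `ε`.

The no-spectral-gap conclusion for every `N` is `Exactness/Phi4HMCNoSpectralGapN.lean`.  NOT CLAIMED:
the size of the thresholds (they grow like towers in `N` — irrelevant to the qualitative statement);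
pqp; `λ = 0`.
-/

namespace Summit.Ventures.LatticeQCDFlow.Exactness

open Real MeasureTheory Filter Finset
open Summit.Ventures.LatticeQCDFlow.Scoring

section TailN

variable {n : ℕ}

/-! ## §2 The `N`-th momentum is huge: `|p_{N,y}| ≥ c_b t^{3^N}` from the far box -/

/-- **After `N ≥ 1` qpq steps from the far box every momentum component is at least `c t^{3^N}` in
size** (for `t` beyond a threshold, uniformly over `φ ∈ A_t` and `|p_y| ≤ t/δ`). -/
theorem leapfrog_momentum_sq_ge_of_mem_box {lam δ : ℝ} (hlam : 0 < lam) (hδ : 0 < δ)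
    (J : Fin (n + 1) → Fin (n + 1) → ℝ) (N : ℕ) (hN : 1 ≤ N) :
    ∃ T cb : ℝ, 1 ≤ T ∧ 0 < cb ∧ ∀ t : ℝ, T ≤ t → ∀ φ p : Fin (n + 1) → ℝ,
      (∀ y, t ≤ φ y ∧ φ y ≤ 2 * t) → (∀ y, |p y| ≤ t / δ) →
      ∀ y, (cb * t ^ (3 ^ N)) ^ 2 ≤ (((leapfrogQPQ J lam δ)^[N] (φ, p)).2 y) ^ 2 := by
  set C : ℝ := ∑ x, ∑ y, |J x y| with hCdef
  have hC : 0 ≤ C := Finset.sum_nonneg fun x _ => Finset.sum_nonneg fun y _ => abs_nonneg _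
  set Φ : ℝ × ℝ × ℝ × ℝ → ℝ × ℝ × ℝ × ℝ := fun w => (δ * w.2.2.1 - w.2.1, δ * w.2.2.2,
      δ * (4 * lam * (δ * w.2.2.1 - w.2.1) ^ 3 - 2 * C * (δ * w.2.2.2)) - w.2.2.2,
      δ * (4 * lam * (δ * w.2.2.2) ^ 3 + 2 * C * (δ * w.2.2.2)) + w.2.2.2) with hΦ
  obtain ⟨T, ca, CA, cb, CB, hT, hca, hCA, hcb, hCB, hk⟩ :=
    levels_growth hlam hδ C hC Φ hΦ (N - 1)
  -- also the kick threshold of stage zero: `t ≥ 1 + (1/δ + 5δC)/(δλ/4)`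
  set C2 : ℝ := (1 / δ + 5 * δ * C) / (δ * lam / 4) with hC2
  have hC20 : 0 ≤ C2 := by positivity
  refine ⟨max T (1 + C2), cb, le_trans hT (le_max_left _ _), hcb, fun t ht φ p hφ hp y => ?_⟩
  have htT : T ≤ t := le_trans (le_max_left _ _) ht
  have ht1 : 1 ≤ t := le_trans hT htT
  have ht0 : 0 < t := by linarith
  have hC2t : C2 ≤ t ^ 2 := by
    have : C2 ≤ t := by linarith [le_max_right T (1 + C2)]
    nlinarith
  have hbig : t / δ + 5 * δ * t * C ≤ δ * lam * t ^ 3 / 4 := kick_threshold hlam hδ ht1 hC2t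
  obtain ⟨hpos, -, -, hb, -, -⟩ := hk t htT
  -- stage zero and `N − 1` further steps
  obtain ⟨hu0, hp0⟩ := stage_zero_of_mem_box hlam.le hδ ht0.le J hφ hp hbig
  have hstages := leapfrogQPQ_stages hlam.le hδ J (N - 1) (σ := 1) (Or.inl rfl)
    (t / 2, 5 * t / 2, δ * lam * t ^ 3 / 4, t / δ + δ * (4 * lam * (5 * t / 2) ^ 3 + 2 * C * (5 * t / 2)))
    (φ, p) hu0 hp0 hpos
  obtain ⟨-, hkick⟩ := hstages
  have hy := (hkick y).1
  -- the `N`-th momentum is the kick at stage `N − 1`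
  have hN' : N = N - 1 + 1 := (Nat.sub_add_cancel hN).symm
  have ep : ((leapfrogQPQ J lam δ)^[N] (φ, p)).2
      = lfKick J lam δ (lfDrift (δ / 2) ((leapfrogQPQ J lam δ)^[N - 1] (φ, p)).1
          ((leapfrogQPQ J lam δ)^[N - 1] (φ, p)).2) ((leapfrogQPQ J lam δ)^[N - 1] (φ, p)).2 := by
    conv_lhs => rw [hN', Function.iterate_succ_apply']
    rfl
  rw [ep]
  set q := lfKick J lam δ (lfDrift (δ / 2) ((leapfrogQPQ J lam δ)^[N - 1] (φ, p)).1
      ((leapfrogQPQ J lam δ)^[N - 1] (φ, p)).2) ((leapfrogQPQ J lam δ)^[N - 1] (φ, p)).2 y with hq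
  have hs2 : ((-1 : ℝ) ^ (N - 1) * 1) ^ 2 = 1 := by
    rw [mul_one, ← pow_mul, mul_comm, pow_mul]; norm_num
  have hlow : cb * t ^ (3 ^ N) ≤ -((-1 : ℝ) ^ (N - 1) * 1) * q := by
    have h := le_trans hb hy
    rw [← hN'] at h
    exact h
  have hcb0 : 0 ≤ cb * t ^ (3 ^ N) := by positivity
  calc (cb * t ^ (3 ^ N)) ^ 2 ≤ (-((-1 : ℝ) ^ (N - 1) * 1) * q) ^ 2 := pow_le_pow_left₀ hcb0 hlow 2
    _ = q ^ 2 := by rw [neg_mul, neg_sq, mul_pow, hs2, one_mul]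

/-! ## §3 The `N`-step energy gap from the far box -/

/-- The energy bookkeeping: a lower bound `(c t^{3^N})² ≤ p_{N,y}²` on every final momentum, the box
bounds on the initial energy, and the threshold `b + c + d + L ≤ a t²` give `H(Ψ_N z) − H(z) ≥ L`. -/
theorem hmc_energy_gap_of_momentum_bound {lam δ t cb L : ℝ} (hlam : 0 < lam) (hδ : 0 < δ)
    (ht : 1 ≤ t) (J : Fin (n + 1) → Fin (n + 1) → ℝ) (N : ℕ) (hN : 1 ≤ N) (hL : 0 ≤ L)
    {φ p : Fin (n + 1) → ℝ} (hφ : ∀ y, t ≤ φ y ∧ φ y ≤ 2 * t) (hp : ∀ y, |p y| ≤ t / δ)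
    (hmom : ∀ y, (cb * t ^ (3 ^ N)) ^ 2 ≤ (((leapfrogQPQ J lam δ)^[N] (φ, p)).2 y) ^ 2)
    (hthr : 16 * lam * ((n : ℝ) + 1) + (4 * (∑ x, ∑ y, |J x y|) + ((n : ℝ) + 1) * (1 / δ) ^ 2 / 2)
        + ((n : ℝ) + 1) * (((∑ x, ∑ y, |J x y|) + 1) ^ 2 / (4 * lam)) + L
        ≤ ((n : ℝ) + 1) * cb ^ 2 / 2 * t ^ 2) :
    L ≤ phi4HmcEnergy J lam (hmcProposal J lam δ N (φ, p)) - phi4HmcEnergy J lam (φ, p) := by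
  have ht0 : 0 < t := by linarith
  have hV0 : (0 : ℝ) < (n : ℝ) + 1 := by positivity
  have hC : 0 ≤ ∑ x, ∑ y, |J x y| := Finset.sum_nonneg fun x _ => Finset.sum_nonneg fun y _ => abs_nonneg _
  -- the polynomial gap
  have H1 : L ≤ ((n : ℝ) + 1) * cb ^ 2 / 2 * t ^ 6 - 16 * lam * ((n : ℝ) + 1) * t ^ 4
      - (4 * (∑ x, ∑ y, |J x y|) + ((n : ℝ) + 1) * (1 / δ) ^ 2 / 2) * t ^ 2
      - ((n : ℝ) + 1) * (((∑ x, ∑ y, |J x y|) + 1) ^ 2 / (4 * lam)) :=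
    poly_gap_ge (by positivity) (by positivity) hL ht hthr
  -- the final kinetic energy dominates `a t⁶`
  have ht6 : t ^ 6 ≤ (t ^ (3 ^ N)) ^ 2 := by
    rw [← pow_mul]
    refine pow_le_pow_right₀ ht ?_
    have : 3 ≤ 3 ^ N := by
      calc 3 = 3 ^ 1 := by norm_num
        _ ≤ 3 ^ N := Nat.pow_le_pow_right (by norm_num) hN
    omega
  have hkin : ((n : ℝ) + 1) * (cb * t ^ (3 ^ N)) ^ 2 ≤ ∑ y, (((leapfrogQPQ J lam δ)^[N] (φ, p)).2 y) ^ 2 := by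
    calc ((n : ℝ) + 1) * (cb * t ^ (3 ^ N)) ^ 2 = ∑ _y : Fin (n + 1), (cb * t ^ (3 ^ N)) ^ 2 := by
          rw [Finset.sum_const, Finset.card_univ, Fintype.card_fin, nsmul_eq_mul]; push_cast; ring
      _ ≤ _ := Finset.sum_le_sum fun y _ => hmom y
  have H2 : ((n : ℝ) + 1) * cb ^ 2 / 2 * t ^ 6
      ≤ (∑ y, (((leapfrogQPQ J lam δ)^[N] (φ, p)).2 y) ^ 2) / 2 := by
    have h1 : cb ^ 2 * t ^ 6 ≤ (cb * t ^ (3 ^ N)) ^ 2 := by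
      rw [mul_pow]; exact mul_le_mul_of_nonneg_left ht6 (sq_nonneg _)
    nlinarith [mul_le_mul_of_nonneg_left h1 hV0.le]
  -- the final action is bounded below, the initial energy bounded above
  have H3 : -(((n : ℝ) + 1) * (((∑ x, ∑ y, |J x y|) + 1) ^ 2 / (4 * lam)))
      ≤ latticePhi4Action J lam ((leapfrogQPQ J lam δ)^[N] (φ, p)).1 := by
    have h := latticePhi4Action_coercive hlam J ((leapfrogQPQ J lam δ)^[N] (φ, p)).1
    have h0 : 0 ≤ ∑ w, ((leapfrogQPQ J lam δ)^[N] (φ, p)).1 w ^ 2 :=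
      Finset.sum_nonneg fun w _ => sq_nonneg _
    linarith
  have hS0 := latticePhi4Action_le_of_mem_box hlam.le ht0.le J hφ
  have hkin0 : ∑ x, p x ^ 2 ≤ ((n : ℝ) + 1) * (t / δ) ^ 2 := by
    have hx : ∀ x, p x ^ 2 ≤ (t / δ) ^ 2 := fun x => by
      rw [← sq_abs]; exact pow_le_pow_left₀ (abs_nonneg _) (hp x) 2
    calc ∑ x, p x ^ 2 ≤ ∑ _x : Fin (n + 1), (t / δ) ^ 2 := Finset.sum_le_sum fun x _ => hx x
      _ = ((n : ℝ) + 1) * (t / δ) ^ 2 := by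
          rw [Finset.sum_const, Finset.card_univ, Fintype.card_fin, nsmul_eq_mul]; push_cast; ring
  have eS : 4 * t ^ 2 * (∑ x, ∑ y, |J x y|) + 16 * lam * ((n : ℝ) + 1) * t ^ 4
      + ((n : ℝ) + 1) * (t / δ) ^ 2 / 2
      = (4 * (∑ x, ∑ y, |J x y|) + ((n : ℝ) + 1) * (1 / δ) ^ 2 / 2) * t ^ 2
        + 16 * lam * ((n : ℝ) + 1) * t ^ 4 := by ring
  have H45 : latticePhi4Action J lam φ + (∑ x, p x ^ 2) / 2
      ≤ (4 * (∑ x, ∑ y, |J x y|) + ((n : ℝ) + 1) * (1 / δ) ^ 2 / 2) * t ^ 2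
        + 16 * lam * ((n : ℝ) + 1) * t ^ 4 := by
    linarith [hS0, hkin0, eS]
  -- unfold the energies
  have hprop : hmcProposal J lam δ N (φ, p) = momFlip ((leapfrogQPQ J lam δ)^[N] (φ, p)) := rfl
  rw [hprop]
  unfold phi4HmcEnergy momFlip
  simp only [Pi.neg_apply, neg_sq]
  linarith [H1, H2, H3, H45]

/-- **THE `N`-STEP PROPOSAL RAISES THE ENERGY BY ANY PRESCRIBED AMOUNT.**  Every `N ≥ 1`, `λ > 0`,
real `J`, `δ > 0`: for every `L ≥ 0` there is `T ≥ 1` such that for `t ≥ T`, `φ ∈ A_t` and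
`|p_y| ≤ t/δ`: `H(Ψ_N(φ,p)) − H(φ,p) ≥ L`, `Ψ_N = hmcProposal J λ δ N`. -/
theorem hmc_energy_gap_of_mem_box_N {lam δ : ℝ} (hlam : 0 < lam) (hδ : 0 < δ)
    (J : Fin (n + 1) → Fin (n + 1) → ℝ) (N : ℕ) (hN : 1 ≤ N) {L : ℝ} (hL : 0 ≤ L) :
    ∃ T : ℝ, 1 ≤ T ∧ ∀ t : ℝ, T ≤ t → ∀ φ p : Fin (n + 1) → ℝ,
      (∀ y, t ≤ φ y ∧ φ y ≤ 2 * t) → (∀ y, |p y| ≤ t / δ) →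
      L ≤ phi4HmcEnergy J lam (hmcProposal J lam δ N (φ, p)) - phi4HmcEnergy J lam (φ, p) := by
  obtain ⟨T, cb, hT, hcb, hmom⟩ := leapfrog_momentum_sq_ge_of_mem_box hlam hδ J N hN
  have hV0 : (0 : ℝ) < (n : ℝ) + 1 := by positivity
  obtain ⟨C1, hC1, hC10⟩ : ∃ C1 : ℝ, C1 = (16 * lam * ((n : ℝ) + 1)
      + (4 * (∑ x, ∑ y, |J x y|) + ((n : ℝ) + 1) * (1 / δ) ^ 2 / 2)
      + ((n : ℝ) + 1) * (((∑ x, ∑ y, |J x y|) + 1) ^ 2 / (4 * lam)) + L)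
        / (((n : ℝ) + 1) * cb ^ 2 / 2) ∧ 0 ≤ C1 := ⟨_, rfl, by positivity⟩
  refine ⟨max T (1 + C1), le_trans hT (le_max_left _ _), fun t ht φ p hφ hp => ?_⟩
  have htT : T ≤ t := le_trans (le_max_left _ _) ht
  have ht1 : 1 ≤ t := le_trans hT htT
  have hC1t : C1 ≤ t ^ 2 := by
    have : C1 ≤ t := by linarith [le_max_right T (1 + C1)]
    nlinarith
  have hthr := (div_le_iff₀ (by positivity : (0 : ℝ) < ((n : ℝ) + 1) * cb ^ 2 / 2)).mp (hC1 ▸ hC1t)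
  exact hmc_energy_gap_of_momentum_bound hlam hδ ht1 J N hN hL hφ hp (hmom t htT φ p hφ hp)
    (by linarith)

/-! ## §4 From an energy gap to a small acceptance probability (any `N`) -/

/-- **Pointwise acceptance bound from a gap**: if `H(Ψ(φ,p)) − H(φ,p) ≥ L` for all momenta with
`|p_y| ≤ t/δ` (`t > 0`), then for EVERY `p`: `a(φ, p) ≤ e^{−L} + (δ/t)² Σ_x p_x²`. -/
theorem involAccept_le_of_gap {lam δ t L : ℝ} (hδ : 0 < δ) (ht : 0 < t)
    (J : Fin (n + 1) → Fin (n + 1) → ℝ) (N : ℕ) {φ : Fin (n + 1) → ℝ}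
    (hgap : ∀ p : Fin (n + 1) → ℝ, (∀ y, |p y| ≤ t / δ) →
      L ≤ phi4HmcEnergy J lam (hmcProposal J lam δ N (φ, p)) - phi4HmcEnergy J lam (φ, p))
    (p : Fin (n + 1) → ℝ) :
    involAccept (phi4HmcEnergy J lam) (hmcProposal J lam δ N) (φ, p)
      ≤ Real.exp (-L) + (δ / t) ^ 2 * ∑ x, p x ^ 2 := by
  have hsum0 : 0 ≤ (δ / t) ^ 2 * ∑ x, p x ^ 2 :=
    mul_nonneg (sq_nonneg _) (Finset.sum_nonneg fun x _ => sq_nonneg _)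
  by_cases hG : ∀ y, |p y| ≤ t / δ
  · have hΔ := hgap p hG
    unfold involAccept
    calc min 1 (Real.exp (phi4HmcEnergy J lam (φ, p)
          - phi4HmcEnergy J lam (hmcProposal J lam δ N (φ, p))))
        ≤ Real.exp (phi4HmcEnergy J lam (φ, p)
          - phi4HmcEnergy J lam (hmcProposal J lam δ N (φ, p))) := min_le_right _ _
      _ ≤ Real.exp (-L) := Real.exp_le_exp.mpr (by linarith)
      _ ≤ Real.exp (-L) + (δ / t) ^ 2 * ∑ x, p x ^ 2 := le_add_of_nonneg_right hsum0
  · push Not at hG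
    obtain ⟨y, hy⟩ := hG
    have h1 : (1 : ℝ) ≤ (δ / t) ^ 2 * ∑ x, p x ^ 2 := by
      have hy2 : (t / δ) ^ 2 < p y ^ 2 := by
        rw [← sq_abs (p y)]
        exact pow_lt_pow_left₀ hy (by positivity) two_ne_zero
      have hle : p y ^ 2 ≤ ∑ x, p x ^ 2 :=
        Finset.single_le_sum (f := fun x => p x ^ 2) (fun x _ => sq_nonneg _) (Finset.mem_univ y)
      have e : (δ / t) ^ 2 * (t / δ) ^ 2 = 1 := by field_simp
      have hδt : 0 < (δ / t) ^ 2 := by positivity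
      nlinarith
    calc involAccept (phi4HmcEnergy J lam) (hmcProposal J lam δ N) (φ, p) ≤ 1 :=
          involAccept_le_one _ _ _
      _ ≤ (δ / t) ^ 2 * ∑ x, p x ^ 2 := h1
      _ ≤ Real.exp (-L) + (δ / t) ^ 2 * ∑ x, p x ^ 2 := le_add_of_nonneg_left (Real.exp_pos _).le

/-- **Averaged acceptance bound from a gap**: `Z_p⁻¹ ∫ a(φ, p) e^{−½Σp²} dp ≤ e^{−L} + V(δ/t)²`. -/
theorem accept_le_of_gap {lam δ t L : ℝ} (hδ : 0 < δ) (ht : 0 < t)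
    (J : Fin (n + 1) → Fin (n + 1) → ℝ) (N : ℕ) {φ : Fin (n + 1) → ℝ}
    (hgap : ∀ p : Fin (n + 1) → ℝ, (∀ y, |p y| ≤ t / δ) →
      L ≤ phi4HmcEnergy J lam (hmcProposal J lam δ N (φ, p)) - phi4HmcEnergy J lam (φ, p)) :
    (∫ p, involAccept (phi4HmcEnergy J lam) (hmcProposal J lam δ N) (φ, p) * momentumWeight p)
        / momentumZ n
      ≤ Real.exp (-L) + ((n : ℝ) + 1) * (δ / t) ^ 2 := by
  have hZp := momentumZ_pos n
  rw [div_le_iff₀ hZp]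
  have hpt := involAccept_le_of_gap hδ ht J N hgap
  have e : ∀ p : Fin (n + 1) → ℝ, (Real.exp (-L) + (δ / t) ^ 2 * ∑ x, p x ^ 2) * momentumWeight p
      = Real.exp (-L) * momentumWeight p + (δ / t) ^ 2 * ∑ x, p x ^ 2 * momentumWeight p := by
    intro p
    rw [add_mul, mul_assoc, Finset.sum_mul]
  have hI1 : Integrable (fun p : Fin (n + 1) → ℝ =>
      (Real.exp (-L) + (δ / t) ^ 2 * ∑ x, p x ^ 2) * momentumWeight p) := by
    simp_rw [e]
    exact (integrable_momentumWeight.const_mul _).add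
      ((integrable_finsetSum _ fun x _ => integrable_sq_mul_momentumWeight x).const_mul _)
  calc ∫ p, involAccept (phi4HmcEnergy J lam) (hmcProposal J lam δ N) (φ, p) * momentumWeight p
      ≤ ∫ p : Fin (n + 1) → ℝ, (Real.exp (-L) + (δ / t) ^ 2 * ∑ x, p x ^ 2) * momentumWeight p := by
        refine integral_mono_of_nonneg (Eventually.of_forall fun p =>
          mul_nonneg (involAccept_nonneg _ _ _) (Real.exp_pos _).le) hI1
          (Eventually.of_forall fun p => ?_)
        exact mul_le_mul_of_nonneg_right (hpt p) (Real.exp_pos _).le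
    _ = Real.exp (-L) * momentumZ n + (δ / t) ^ 2 * (((n : ℝ) + 1) * momentumZ n) := by
        simp_rw [e]
        rw [integral_add (integrable_momentumWeight.const_mul _)
          ((integrable_finsetSum _ fun x _ => integrable_sq_mul_momentumWeight x).const_mul _),
          integral_const_mul, integral_const_mul,
          integral_finsetSum _ fun x _ => integrable_sq_mul_momentumWeight x]
        simp_rw [integral_sq_mul_momentumWeight]
        rw [Finset.sum_const, Finset.card_univ, Fintype.card_fin, nsmul_eq_mul]
        unfold momentumZ
        push_cast
        ring
    _ = (Real.exp (-L) + ((n : ℝ) + 1) * (δ / t) ^ 2) * momentumZ n := by ring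

/-! ## §5 Tail rejection for every trajectory length -/

/-- **FROM THE FAR BOX, `N`-STEP HMC IS REJECTED — eventually in `t`.**  Every `N ≥ 1`, `λ > 0`,
real `J`, `δ > 0`: for every `ε > 0` there is `T ≥ 1` such that for EVERY `t ≥ T` and every
configuration `φ` with `t ≤ φ_x ≤ 2t` for all `x`, the HMC update `hmcProposal J λ δ N` (refresh,
`N` qpq leapfrog steps of size `δ`, flip, Metropolis test) is accepted with probability at most `ε`. -/
theorem hmcPhi4_accept_le_of_mem_box_eventually {lam δ : ℝ} (hlam : 0 < lam) (hδ : 0 < δ)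
    (J : Fin (n + 1) → Fin (n + 1) → ℝ) (N : ℕ) (hN : 1 ≤ N) {ε : ℝ} (hε : 0 < ε) :
    ∃ T : ℝ, 1 ≤ T ∧ ∀ t : ℝ, T ≤ t → ∀ φ : Fin (n + 1) → ℝ, (∀ y, t ≤ φ y ∧ φ y ≤ 2 * t) →
      (∫ p, involAccept (phi4HmcEnergy J lam) (hmcProposal J lam δ N) (φ, p) * momentumWeight p)
          / momentumZ n ≤ ε := by
  have hL0 : 0 ≤ max 0 (Real.log (2 / ε)) := le_max_left _ _
  obtain ⟨T, hT, hgapT⟩ := hmc_energy_gap_of_mem_box_N hlam hδ J N hN hL0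
  obtain ⟨C3, hC3, hC30⟩ : ∃ C3 : ℝ, C3 = 2 * ((n : ℝ) + 1) * δ ^ 2 / ε ∧ 0 ≤ C3 :=
    ⟨_, rfl, by positivity⟩
  refine ⟨T + C3, by linarith, fun t ht φ hφ => ?_⟩
  have htT : T ≤ t := by linarith
  have ht1 : 1 ≤ t := le_trans hT htT
  have ht0 : 0 < t := by linarith
  have hsq : t ≤ t ^ 2 := by nlinarith [ht1]
  have hc3 : C3 ≤ t := by linarith
  have hcheb := cheb_threshold (δ := δ) (V := (n : ℝ) + 1) ht0 hε (by rw [← hC3]; linarith)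
  have hacc := accept_le_of_gap hδ ht0 J N (fun p hp => hgapT t htT φ p hφ hp)
  have hexp := exp_neg_threshold hε
  linarith

/-- **FROM THE FAR BOX, `N`-STEP HMC IS REJECTED.**  Every `N ≥ 1`, `λ > 0`, real `J`, `δ > 0`: for
every `ε > 0` and every `T₀` there is `t ≥ max(T₀, 1)` such that from EVERY configuration `φ` with
`t ≤ φ_x ≤ 2t` for all `x` the `N`-step HMC update is accepted with probability at most `ε`. -/
theorem hmcPhi4_accept_le_of_mem_box {lam δ : ℝ} (hlam : 0 < lam) (hδ : 0 < δ)
    (J : Fin (n + 1) → Fin (n + 1) → ℝ) (N : ℕ) (hN : 1 ≤ N) {ε : ℝ} (hε : 0 < ε) (T₀ : ℝ) :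
    ∃ t : ℝ, T₀ ≤ t ∧ 1 ≤ t ∧ ∀ φ : Fin (n + 1) → ℝ, (∀ y, t ≤ φ y ∧ φ y ≤ 2 * t) →
      (∫ p, involAccept (phi4HmcEnergy J lam) (hmcProposal J lam δ N) (φ, p) * momentumWeight p)
          / momentumZ n ≤ ε := by
  obtain ⟨T, hT, hall⟩ := hmcPhi4_accept_le_of_mem_box_eventually hlam hδ J N hN hε
  exact ⟨max T₀ T, le_max_left _ _, le_trans hT (le_max_right _ _),
    fun φ hφ => hall _ (le_max_right _ _) φ hφ⟩

end TailN

end Summit.Ventures.LatticeQCDFlow.Exactness
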